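/-
Origin: expansion seat `planner-pub-hodgecm-mc-axioms-1-g14-0`, handover #W157 2026-08-20T15:53:55Z md5 632974235dae (PKG d99a64657708 → 632974235dae; 125 l.; MECHANICAL (iib-R) rewrite v3.1 of the PKG file as it stands (93 token edits; rules R1x1+RX[h₂]x92)) (`HOME/mc/pub-hodgecm-mc-axioms-1-g14/revendor/kit-r55/stage55/HodgeCM/Model/E2InstanceR8A.lean`, md5 632974235dae, 125 lines);
landed by the gen-22 packager (p-g22) in gate run 55 REPLACES the earlier landed copy of `HodgeCM/Model/E2InstanceR8A.lean` (seat copy carried the packager Origin header of an earlier run (stripped)).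
-/
/-
Origin: CONSTRUCTION seat `planner-pub-hodgecm-mc-glue-1-g6-0` (unit pub-hodgecm-mc-glue-1-g6, gen 6 of mc-glue-1, node E ASSEMBLER), 2026-08-19T18:00Z — revision (§60) of `HodgeCM/Model/E2InstanceR8A.lean` for RUN 37: the (Θ-sat-≤) ORDER CASCADE (BINDER-TRIAGE §60: theta saturation in the `K`-order `Γ' ≤ Γ :↔ Γ'.K ≤ Γ.K` of the (W1) `Level`-pair root, covers `cover Γ Γ' (Level.Γ_mono h)`), forced by the K-order `Model.thetaSatOf` (theta-3-g9 t37 #C2); kit `mc/pub-hodgecm-mc-glue-1-g6/t37c-mcglue1g6.txt`; base PKG (RUN-35 bytes, glue-1 lineage). REPLACE — binder `thetaSat` re-typed to the K-order (1 occurrence), as R6. Kernel only: 0 `proof-hole`, 0 new declarations, cites nothing new; expected `#print axioms` unchanged (⊆ {propext, Classical.choice, Quot.sound}).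
-/
/-
Origin: expansion seat `planner-pub-hodgecm-mc-glue-1-g4-0`, handover #306 2026-08-19T00:59Z md5 31d91b8e85829ed21e166bc827c84f2f (NEW PKG leaf, 114 l.; farm run33l rc 0 / 0 warnings, axioms trio; node E END STATE revision 8A: theorem Model.perL_picardCM_r8a : (picardCMUniverse hHD hI h₁ h₃).PerL := perL_picardCM_r8 … at A := fun V c hc h6 k hk N hN => (C V c hc h6 k hk N hN).toSupplySituationAt (hol V c hc h6 k hk N hN) — the one record-valued supply binder `A V (`HOME/mc/pub-hodgecm-mc-glue-1-g4/lean/E2InstanceR8A.lean`, md5 31d91b8e, 114 lines);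
landed by the gen-9 packager (p-g9) in gate run 33 as `HodgeCM/Model/E2InstanceR8A.lean` (verbatim).
-/
/-
Origin: CONSTRUCTION seat `planner-pub-hodgecm-mc-glue-1-g4-0` (unit pub-hodgecm-mc-glue-1-g4, gen 4 of mc-glue-1,
node E ASSEMBLER), 2026-08-19.  NEW additive leaf `HodgeCM/Model/E2InstanceR8A.lean`.  Imports: `E2InstanceR8`
(revision 8) and `ArchKType` (mc-theta-3-g3: `Model.ArchKTypeData`, `ArchKTypeData.toSupplySituationAt`).
No proof holes; every undischarged input is an explicit binder.  Expected `#print axioms`: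
{propext, Classical.choice, Quot.sound}.
-/
import Summits.HodgeConjecture.HodgeCM.Model.E2InstanceR8
import Summits.HodgeConjecture.HodgeCM.Model.ArchKType

/-!
# E2 instance, revision 8A: the supply binder `A` CUT FINER (archimedean `K`-type data + holomorphy)

`Model.perL_picardCM_r8a : (picardCMUniverse hHD hI h₁ h₃).PerL` — revision 8 (Riemann headline
`Model.perL_picardCM_r8`) with its one structured supply binder
`A V c hc h6 k hk N hN : SupplySituationAt (X V c) k N` (one supply situation per good sextic context, type index
`k ∈ {0,1}` and `N > 0`) REPLACED, following mc-theta-3-g3's offer R8′ (STATUS 2026-08-19T00:49:05Z), by the pair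

* `C V c hc h6 k hk N hN : ArchKTypeData (X V c) k N` (`HodgeCM/Model/ArchKType.lean`): a level `Γ₀`, a finite
  `K`-type `κ₂ : K₂ →* G_U` commuting with the archimedean inclusion and correcting the level, a harmonic family
  `Φarch : W^∨ →ₗ 𝒮((J → K_∞), ℂ)` through the archimedean test vector, an archimedean Weil representation `ωinf`,
  and the three OPEN statements typed there verbatim — `fixN` (W-Kf′: the finite `K`-type fixes every
  `Φ_∞ ⊗ 1_{x₀+N𝒪̂^J}`), `prodN` (W-⊗′: the archimedean component acts through `ωinf`), `harm` (W-K∞′: `Φarch` is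
  `K_∞`-equivariant of type `τ₁^∨`);
* `hol` (W6b-hol): the restricted theta forms of the product family are holomorphic for the class-map datum at `Γ₀`,

via `A := fun V c hc h6 k hk N hN ↦ (C V c hc h6 k hk N hN).toSupplySituationAt (hol V c hc h6 k hk N hN)` — the
membership `fam` and the situation's `IsLevelCorrected` / `IsWeightMatched` / theta-equivariance fields being KERNEL
theorems of `SupplySituation.lean` / `ArchKType.lean`.  The proof is `Model.perL_picardCM_r8` at that value; nothing
is re-proved.  Strictly finer bookkeeping, same theorem: what was one record-valued binder is now data + four named
`Prop`s, each with an owner in the MODEL-DAG.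

Binders (17): `hHR`, `h`, `hA`, `W`, `X`, `μ`, `hBetti`, `hR`, `hLiu`, `thetaSat`, `transl`, `C`, `hol`, `gen12`,
`real34`, `hyp12`, `hyp34`.
-/

noncomputable section

open scoped TensorProduct InnerProductSpace Matrix

namespace HodgeCM

namespace Model

open HodgeCM.Universe (AdelicThetaCore AdelicThetaCore₀ SideData ThetaModel ModelAxiomsPerL)
open Literature.AlgebraicGeometry.HodgeTheory
open Literature.NumberTheory.Automorphic.PicardCM
open Literature.NumberTheory.Transcendental (Arapura2012_Cor_15_4_6)
open HodgeCM.CMTypeOps (inflate)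

variable (hHD : exists_isReal_hodgeModel) (hI : hodgePQ_independent_of_hodgeModel)
  (h₁ : BallQuotientUniformised)  (h₃ : CMAbelianVarietyRealised)

/-- **E2 instance, revision 8A** — `Model.perL_picardCM_r8` with the supply binder `A` produced from archimedean
`K`-type data `C` and holomorphy `hol` by `ArchKTypeData.toSupplySituationAt` (mc-theta-3-g3). -/
theorem perL_picardCM_r8a (hHR : BettiUniverse.HodgeRiemann20) (h : Bool)
    (hA : Arapura2012_Cor_15_4_6)
    (W : ∀ {L : CMField} {ι₁ : L →+* ℂ} (V : HermSpace3 L ι₁) (c : SeesawCtx L), WmInput V c.D)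
    (X : ∀ {L : CMField} {ι₁ : L →+* ℂ} (V : HermSpace3 L ι₁) (c : SeesawCtx L),
      ThetaSpaceInput (picardCMUniverse hHD hI h₁ h₃) V c)
    (μ : ∀ {L : CMField}, SeesawCtx L → Fin 4 → NumberField.InfinitePlace L → ℤ)
    (hBetti : ∀ {L : CMField} {ι₁ : L →+* ℂ} (V : HermSpace3 L ι₁), EmbBettiSide hHD hI h₁ h₃ V)
    (hR : DeligneMilne1982_Thm_6_20_full)
    (hLiu : ∀ {L : CMField} {ι₁ : L →+* ℂ} (V : HermSpace3 L ι₁) (c : SeesawCtx L),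
      (thetaModelOf hHD hI h₁ h₃ h (embOf hHD hI h₁ h₃) (coverOf hHD hI h₁ h₃ hA) (wmOfInput W) (thetaOf _ (thetaClassInputOf _ X)) (d12Of μ) (d34Of μ)).GoodCtx ι₁ c → Module.finrank ℚ c.K = 6 →
      ∀ (i : Fin 4) (Γ : Level V), ∃ (M : CMField) (k : c.K →+* M) (σ' : M →+* ℂ), σ'.comp k = c.σ ∧
        (thetaModelOf hHD hI h₁ h₃ h (embOf hHD hI h₁ h₃) (coverOf hHD hI h₁ h₃ hA) (wmOfInput W) (thetaOf _ (thetaClassInputOf _ X)) (d12Of μ) (d34Of μ)).Theta V c i Γ ⊆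
          (picardCMUniverse hHD hI h₁ h₃).Uiso Γ M (inflate k (c.Ψ i)) σ')
    (thetaSat : ∀ {L : CMField} {ι₁ : L →+* ℂ} (V : HermSpace3 L ι₁) (c : SeesawCtx L)
      (i : Fin 4) (Γ Γ' : Level V) (hle : Γ' ≤ Γ) (ω : (picardCMUniverse hHD hI h₁ h₃).CohC ((picardCMUniverse hHD hI h₁ h₃).pms L ι₁ V Γ) 1),
      ω ∈ (thetaModelOf hHD hI h₁ h₃ h (embOf hHD hI h₁ h₃) (coverOf hHD hI h₁ h₃ hA) (wmOfInput W) (thetaOf _ (thetaClassInputOf _ X)) (d12Of μ) (d34Of μ)).Theta V c i Γ →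
        (picardCMUniverse hHD hI h₁ h₃).pullC (coverOf hHD hI h₁ h₃ hA Γ Γ' (Level.Γ_mono hle)) 1 ω ∈ (thetaModelOf hHD hI h₁ h₃ h (embOf hHD hI h₁ h₃) (coverOf hHD hI h₁ h₃ hA) (wmOfInput W) (thetaOf _ (thetaClassInputOf _ X)) (d12Of μ) (d34Of μ)).Theta V c i Γ')
    (transl : ∀ {L : CMField} {ι₁ : L →+* ℂ} (V : HermSpace3 L ι₁) (c : SeesawCtx L)
      (hc : (thetaModelOf hHD hI h₁ h₃ h (embOf hHD hI h₁ h₃) (coverOf hHD hI h₁ h₃ hA) (wmOfInput W) (thetaOf _ (thetaClassInputOf _ X)) (d12Of μ) (d34Of μ)).GoodCtx ι₁ c) (hK : Module.finrank ℚ c.K = 6),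
      ∀ γ ∈ (ballOf hHD hI h₁ h₃ V c (two_lt_finrank_of_goodCtx hHD hI h₁ h₃ hc hK)).Δ, ∀ (i : Fin 4) (Γ : Level V) (ω : (picardCMUniverse hHD hI h₁ h₃).CohC ((picardCMUniverse hHD hI h₁ h₃).pms L ι₁ V Γ) 1),
      ω ∈ (thetaModelOf hHD hI h₁ h₃ h (embOf hHD hI h₁ h₃) (coverOf hHD hI h₁ h₃ hA) (wmOfInput W) (thetaOf _ (thetaClassInputOf _ X)) (d12Of μ) (d34Of μ)).Theta V c i Γ → ∃ (Γ' : Level V) (ω' : (picardCMUniverse hHD hI h₁ h₃).CohC ((picardCMUniverse hHD hI h₁ h₃).pms L ι₁ V Γ') 1),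
        ω' ∈ (thetaModelOf hHD hI h₁ h₃ h (embOf hHD hI h₁ h₃) (coverOf hHD hI h₁ h₃ hA) (wmOfInput W) (thetaOf _ (thetaClassInputOf _ X)) (d12Of μ) (d34Of μ)).Theta V c i Γ' ∧ (ballOf hHD hI h₁ h₃ V c (two_lt_finrank_of_goodCtx hHD hI h₁ h₃ hc hK)).ev Γ' ω' =
          fun x => (ballOf hHD hI h₁ h₃ V c (two_lt_finrank_of_goodCtx hHD hI h₁ h₃ hc hK)).J γ x *ᵥ (ballOf hHD hI h₁ h₃ V c (two_lt_finrank_of_goodCtx hHD hI h₁ h₃ hc hK)).ev Γ ω (γ • x))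
    (C : ∀ {L : CMField} {ι₁ : L →+* ℂ} (V : HermSpace3 L ι₁) (c : SeesawCtx L),
      (thetaModelOf hHD hI h₁ h₃ h (embOf hHD hI h₁ h₃) (coverOf hHD hI h₁ h₃ hA) (wmOfInput W) (thetaOf _ (thetaClassInputOf _ X)) (d12Of μ) (d34Of μ)).GoodCtx ι₁ c →
        Module.finrank ℚ c.K = 6 → ∀ k : Fin 4, k = 0 ∨ k = 1 → ∀ N : ℕ, 0 < N → ArchKTypeData (X V c) k N)
    (hol : ∀ {L : CMField} {ι₁ : L →+* ℂ} (V : HermSpace3 L ι₁) (c : SeesawCtx L)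
      (hc : (thetaModelOf hHD hI h₁ h₃ h (embOf hHD hI h₁ h₃) (coverOf hHD hI h₁ h₃ hA) (wmOfInput W) (thetaOf _ (thetaClassInputOf _ X)) (d12Of μ) (d34Of μ)).GoodCtx ι₁ c)
      (h6 : Module.finrank ℚ c.K = 6) (k : Fin 4) (hk : k = 0 ∨ k = 1) (N : ℕ) (hN : 0 < N),
      ∀ f ∈ ((X V c).P k).weightFunctions,
        (C V c hc h6 k hk N hN).toProduct.restrictedThetaForm f ∈ ((X V c).D (C V c hc h6 k hk N hN).Γ₀).Hol)
    (gen12 : ∀ {L : CMField} {ι₁ : L →+* ℂ} (V : HermSpace3 L ι₁) (c : SeesawCtx L),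
      (thetaModelOf hHD hI h₁ h₃ h (embOf hHD hI h₁ h₃) (coverOf hHD hI h₁ h₃ hA) (wmOfInput W) (thetaOf _ (thetaClassInputOf _ X)) (d12Of μ) (d34Of μ)).GoodCtx ι₁ c → Module.finrank ℚ c.K = 6 →
      Nonempty ((thetaModelOf hHD hI h₁ h₃ h (embOf hHD hI h₁ h₃) (coverOf hHD hI h₁ h₃ hA) (wmOfInput W) (thetaOf _ (thetaClassInputOf _ X)) (d12Of μ) (d34Of μ)).Gen12FunBridge V c))
    (real34 : ∀ {L : CMField} {ι₁ : L →+* ℂ} (V : HermSpace3 L ι₁) (c : SeesawCtx L),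
      (thetaModelOf hHD hI h₁ h₃ h (embOf hHD hI h₁ h₃) (coverOf hHD hI h₁ h₃ hA) (wmOfInput W) (thetaOf _ (thetaClassInputOf _ X)) (d12Of μ) (d34Of μ)).GoodCtx ι₁ c → Module.finrank ℚ c.K = 6 →
      Nonempty ((thetaModelOf hHD hI h₁ h₃ h (embOf hHD hI h₁ h₃) (coverOf hHD hI h₁ h₃ hA) (wmOfInput W) (thetaOf _ (thetaClassInputOf _ X)) (d12Of μ) (d34Of μ)).Real34FunBridge V c))
    (hyp12 : ∀ {L : CMField} {ι₁ : L →+* ℂ} (V : HermSpace3 L ι₁) (c : SeesawCtx L),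
      (thetaModelOf hHD hI h₁ h₃ h (embOf hHD hI h₁ h₃) (coverOf hHD hI h₁ h₃ hA) (wmOfInput W) (thetaOf _ (thetaClassInputOf _ X)) (d12Of μ) (d34Of μ)).GoodCtx ι₁ c → Module.finrank ℚ c.K = 6 →
      Nonempty (((coreOf _ (embOf hHD hI h₁ h₃) (coverOf hHD hI h₁ h₃ hA) (wmOfInput W) (thetaOf _ (thetaClassInputOf _ X))).toCore h).HypSmoothCore12
        (((coreOf _ (embOf hHD hI h₁ h₃) (coverOf hHD hI h₁ h₃ hA) (wmOfInput W) (thetaOf _ (thetaClassInputOf _ X))).toCore h).side12 (d12Of μ)) (((coreOf _ (embOf hHD hI h₁ h₃) (coverOf hHD hI h₁ h₃ hA) (wmOfInput W) (thetaOf _ (thetaClassInputOf _ X))).toCore h).side34 (d34Of μ))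
        ((((coreOf _ (embOf hHD hI h₁ h₃) (coverOf hHD hI h₁ h₃ hA) (wmOfInput W) (thetaOf _ (thetaClassInputOf _ X))).toCore h).analyticKM (((coreOf _ (embOf hHD hI h₁ h₃) (coverOf hHD hI h₁ h₃ hA) (wmOfInput W) (thetaOf _ (thetaClassInputOf _ X))).toCore h).side12 (d12Of μ))
          (((coreOf _ (embOf hHD hI h₁ h₃) (coverOf hHD hI h₁ h₃ hA) (wmOfInput W) (thetaOf _ (thetaClassInputOf _ X))).toCore h).side34 (d34Of μ))).toAnalytic) V c (ℓ := linOfInput W V c)))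
    (hyp34 : ∀ {L : CMField} {ι₁ : L →+* ℂ} (V : HermSpace3 L ι₁) (c : SeesawCtx L),
      (thetaModelOf hHD hI h₁ h₃ h (embOf hHD hI h₁ h₃) (coverOf hHD hI h₁ h₃ hA) (wmOfInput W) (thetaOf _ (thetaClassInputOf _ X)) (d12Of μ) (d34Of μ)).GoodCtx ι₁ c → Module.finrank ℚ c.K = 6 →
      Nonempty (((coreOf _ (embOf hHD hI h₁ h₃) (coverOf hHD hI h₁ h₃ hA) (wmOfInput W) (thetaOf _ (thetaClassInputOf _ X))).toCore h).HypSmoothCore34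
        (((coreOf _ (embOf hHD hI h₁ h₃) (coverOf hHD hI h₁ h₃ hA) (wmOfInput W) (thetaOf _ (thetaClassInputOf _ X))).toCore h).side12 (d12Of μ)) (((coreOf _ (embOf hHD hI h₁ h₃) (coverOf hHD hI h₁ h₃ hA) (wmOfInput W) (thetaOf _ (thetaClassInputOf _ X))).toCore h).side34 (d34Of μ))
        ((((coreOf _ (embOf hHD hI h₁ h₃) (coverOf hHD hI h₁ h₃ hA) (wmOfInput W) (thetaOf _ (thetaClassInputOf _ X))).toCore h).analyticKM (((coreOf _ (embOf hHD hI h₁ h₃) (coverOf hHD hI h₁ h₃ hA) (wmOfInput W) (thetaOf _ (thetaClassInputOf _ X))).toCore h).side12 (d12Of μ))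
          (((coreOf _ (embOf hHD hI h₁ h₃) (coverOf hHD hI h₁ h₃ hA) (wmOfInput W) (thetaOf _ (thetaClassInputOf _ X))).toCore h).side34 (d34Of μ))).toAnalytic) V c (ℓ := linOfInput W V c))) :
    (picardCMUniverse hHD hI h₁ h₃).PerL :=
  perL_picardCM_r8 hHD hI h₁ h₃ hHR h hA W X μ hBetti hR hLiu thetaSat transl
    (fun V c hc h6 k hk N hN => (C V c hc h6 k hk N hN).toSupplySituationAt (hol V c hc h6 k hk N hN))
    gen12 real34 hyp12 hyp34

end Model

end HodgeCM

end
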